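import Summits.CriticalPhenomena.PercolationContinuityZ3.Theorems.Transplant.FKConnectivityAllQForestAdjacentGuard
import Summits.CriticalPhenomena.PercolationContinuityZ3.Theorems.Transplant.FKConnectivityAllQForestAdjacentNoSqSplit
import Summits.CriticalPhenomena.PercolationContinuityZ3.Theorems.Transplant.FKConnectivityAllQForestSquareCex
import HarnessLib

/-!
# The square-free adjacent forest Rayleigh inequality HOLDS at every vertex of degree ≤ 3 (all graphs, all fibres)

Support file (`--supports stmt-CriticalPhenomena-4575`), FK sub-lane `prim-bschramm-fk-1` (gen 18) of the post-continuity programme;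
builds on p205010 (kernel theorem, internal audit signed; external expert review pending).  No definitions, no named facts, no sorries;
standard axioms.

THE NODE (`AdjForestRayleighNoSqOn`, fk-1 g16, `…TwoClusterRayleighNoSq.lean`): for `e = ov ≠ f = oy` and every fibre `(M, u₀)`,
`#(Fo ∩ {e, f ∈ ω}, Fo) ≤ #(Fo ∩ {e ∈ ω}, Fo ∩ {f ∈ ω})` — coefficientwise Rayleigh monotonicity of the spanning-forest polynomial at an
ADJACENT pair of edges; equivalently (this generation's reading, memo bschramm/FROM-fk-1-g18-VERTEX-NC.md): in a uniformly random ordered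
partition of the edges of a finite multigraph into two forests, the colours of two edges at a common vertex are negatively correlated.
It is open (it implies the adjacent case of the Grimmett–Winkler / Pemantle / Kahn negative-correlation problem for uniform forests),
exhaustively verified on every simple graph with ≤ 10 vertices (this generation), and false for non-adjacent pairs (`…ForestRayleighK4.lean`).

THIS FILE proves the first POSITIVE structural case in the tree: the guarded fibre inequality, hence the node's inequality on the split
fibre `(M ∪ {e, f}, u₀)`, holds whenever the vertex `o` meets AT MOST ONE pair of `M ∪ u₀`, and that pair is not in the contracted part `u₀`
("`o` has degree ≤ 3 in the multigraph `(M ∪ u₀)/u₀ + e + f`"; every other vertex and the rest of the fibre are arbitrary):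
* tools: **`fibreCount_swap`** (the involution `ω ↦ ω ∆ M`: `#_{(M,u)}(A, B) = #_{(M,u)}(B, A)`), **`fibreCount_split_left`**
  (additivity in the first event), **`fibreCount_insert_one`** (one pair `g ∉ M` inserted: `#_{(M ∪ {g}, u)}(P, Q) =
  #_{(M,u)}({g ∉ ω} ∩ {ω ∪ {g} ∈ P}, {g ∉ ω} ∩ Q) + #_{(M,u)}({g ∉ ω} ∩ P, {g ∉ ω} ∩ {ω ∪ {g} ∈ Q})`), and the forest criteria at an
  ISOLATED vertex `o`: **`eq_of_reachable_of_isolated`**, **`isForestCfg_insert_of_isolated`** (`ω ∪ {ox} ∈ Fo ↔ ω ∈ Fo`),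
  **`isForestCfg_insert_two_of_isolated`** (`ω ∪ {ov, oy} ∈ Fo ↔ ω ∈ Fo ∧ v ↮ y`), **`isForestCfg_insert_three_of_isolated`**
  (`ω ∪ {oz, ov, oy} ∈ Fo ↔ ω ∈ Fo ∧ v ↮ y ∧ v ↮ z ∧ y ↮ z`);
* **`adjForestNoSq_guarded_of_deg_le_three`**: the guarded inequality on `(M, u₀)` under the degree hypothesis — degree 2: `bad ⊆ good`
  configuration by configuration; degree 3 (third pair `g = oz ∈ M`): after splitting off `g` and swapping one term by the involution,
  the four counts are `#[v|y|z] + #[v ↮ y] ≤ #[v ↮ z] + #[y ↮ z]` for the open clusters of ONE configuration, which holds because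
  `{v|y|z} ⊔ {v ↮ y, v ~ z} ⊆ {y ↮ z}` and `{v ↮ y, v ↮ z} ⊆ {v ↮ z}`;
* **`adjForestNoSq_fibre_of_deg_le_three`**: the node's inequality on the split fibre `(M ∪ {e,f}, u₀)` (via g17's
  `adjForestNoSq_fibre_of_guarded`).
Degree 4 is the first case that is NOT pointwise in the pair of cluster partitions (memo §2; g16's 9-vertex counterexample to the
square-strengthened node has `deg o = 4` there).
[cite: SempleWelsh2008, Conj. 1.1 (p. 2); Thm. 4.2 (p. 11)] [cite: CibulkaHladkyLaCroixWagner2008, Thm. 1 (p. 2)] [cite: Linusson2011, Prop. 2.6]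
[cite: Grimmett2006, §1.5 (p. 13)]
-/

noncomputable section

namespace Summit.CriticalPhenomena.PercolationContinuityZ3.Theorems
namespace FK

open MeasureTheory Set Literature.Probability.LatticeModels Literature.Probability.Percolation
open scoped Classical symmDiff

variable {V : Type*} [Fintype V]

/-! ### Fibre-count tools: the involution, congruence, additivity, one inserted pair -/

/-- **The involution `ω ↦ ω ∆ M`** exchanges the two events of a fibre count. [cite: Linusson2011, Prop. 2.6] -/
theorem fibreCount_swap (M u : BondConfig V) (A B : Set (BondConfig V)) : fibreCount M u A B = fibreCount M u B A := by
  refine fibreCount_eq_of_bij (fun ω => ω ∆ M) (fun ω => ω ∆ M) (fun ω hω hA hB => ?_) (fun ω hω hA hB => ?_) <;>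
    exact ⟨by rw [symmDiff_sdiff_self_right, hω], hB, by rw [symmDiff_symmDiff_cancel_right]; exact hA,
      symmDiff_symmDiff_cancel_right _ _⟩

/-- **Congruence on the fibre**: events that agree on the configurations of the fibre give the same count. [cite: Linusson2011, Prop. 2.6] -/
theorem fibreCount_congr_fibre (M u : BondConfig V) {A B A' B' : Set (BondConfig V)}
    (h : ∀ ω : BondConfig V, ω \ M = u → ((ω ∈ A ∧ ω ∆ M ∈ B) ↔ (ω ∈ A' ∧ ω ∆ M ∈ B'))) :
    fibreCount M u A B = fibreCount M u A' B' :=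
  le_antisymm (fibreCount_mono_fibre M u fun ω hω hA hB => (h ω hω).1 ⟨hA, hB⟩)
    (fibreCount_mono_fibre M u fun ω hω hA hB => (h ω hω).2 ⟨hA, hB⟩)

/-- **Additivity in the first event** for disjoint events. [cite: Linusson2011, Prop. 2.6] -/
theorem fibreCount_split_left (M u : BondConfig V) {A₁ A₂ : Set (BondConfig V)} (B : Set (BondConfig V)) (hd : Disjoint A₁ A₂) :
    fibreCount M u (A₁ ∪ A₂) B = fibreCount M u A₁ B + fibreCount M u A₂ B := by
  unfold fibreCount
  rw [← Finset.card_union_of_disjoint]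
  · congr 1
    ext ω
    simp only [Finset.mem_filter, Finset.mem_univ, true_and, Finset.mem_union, mem_union]
    tauto
  · rw [Finset.disjoint_left]
    intro ω h₁ h₂
    rw [Finset.mem_filter] at h₁ h₂
    exact hd.le_bot ⟨h₁.2.2.1, h₂.2.2.1⟩

section OnePair

variable {M u : BondConfig V} {g : Sym2 V}

omit [Fintype V] in
/-- `(ω ∪ {g}) ∖ (M ∪ {g}) = ω ∖ M` for `g ∉ ω`. [folklore] -/
theorem insert_sdiff_insert_of_notMem {ω : BondConfig V} (hg : g ∉ ω) : insert g ω \ insert g M = ω \ M := by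
  ext x; simp only [mem_sdiff, mem_insert_iff, not_or]
  constructor
  · rintro ⟨rfl | hx, hxg, hxM⟩ <;> tauto
  · rintro ⟨hx, hxM⟩; exact ⟨Or.inr hx, by rintro rfl; exact hg hx, hxM⟩

omit [Fintype V] in
/-- `(ω ∪ {g}) ∆ (M ∪ {g}) = ω ∆ M` for `g ∉ ω`, `g ∉ M`. [folklore] -/
theorem insert_symmDiff_insert_of_notMem {ω : BondConfig V} (hg : g ∉ ω) (hgM : g ∉ M) : insert g ω ∆ insert g M = ω ∆ M := by
  ext x; simp only [Set.mem_symmDiff, mem_insert_iff]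
  by_cases hx : x = g
  · subst hx; tauto
  · tauto

omit [Fintype V] in
/-- `ω ∖ (M ∪ {g}) = ω ∖ M` for `g ∉ ω`. [folklore] -/
theorem sdiff_insert_of_notMem {ω : BondConfig V} (hg : g ∉ ω) : ω \ insert g M = ω \ M := by
  ext x; simp only [mem_sdiff, mem_insert_iff, not_or]
  by_cases hx : x = g
  · subst hx; tauto
  · tauto

omit [Fintype V] in
/-- `ω ∆ (M ∪ {g}) = (ω ∆ M) ∪ {g}` for `g ∉ ω`. [folklore] -/
theorem symmDiff_insert_of_notMem {ω : BondConfig V} (hg : g ∉ ω) : ω ∆ insert g M = insert g (ω ∆ M) := by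
  ext x; simp only [Set.mem_symmDiff, mem_insert_iff]
  by_cases hx : x = g
  · subst hx; tauto
  · tauto

omit [Fintype V] in
/-- On the fibre `(M ∪ {g}, u)`: a configuration, minus `g`, lies on the fibre `(M, u)`. [folklore] -/
theorem sdiff_singleton_sdiff_of_fibre {ω : BondConfig V} (hω : ω \ insert g M = u) : (ω \ {g}) \ M = u := by
  rw [← hω]; ext x; simp only [mem_sdiff, mem_singleton_iff, mem_insert_iff, not_or]
  constructor
  · rintro ⟨⟨hx, hxg⟩, hxM⟩; exact ⟨hx, hxg, hxM⟩
  · rintro ⟨hx, hxg, hxM⟩; exact ⟨⟨hx, hxg⟩, hxM⟩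

/-- **One pair inserted into the free part**: for `g ∉ M`,
`#_{(M ∪ {g}, u)}(P, Q) = #_{(M,u)}({g ∉ ω} ∩ {ω ∪ {g} ∈ P}, {g ∉ ω} ∩ Q) + #_{(M,u)}({g ∉ ω} ∩ P, {g ∉ ω} ∩ {ω ∪ {g} ∈ Q})`
(the pair `g` goes to the configuration or to its partner). [cite: Linusson2011, Prop. 2.6] -/
theorem fibreCount_insert_one (hgM : g ∉ M) (P Q : Set (BondConfig V)) :
    fibreCount (insert g M) u P Q =
      fibreCount M u ({ω | g ∉ ω} ∩ {ω | insert g ω ∈ P}) ({ω | g ∉ ω} ∩ Q) +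
        fibreCount M u ({ω | g ∉ ω} ∩ P) ({ω | g ∉ ω} ∩ {ω | insert g ω ∈ Q}) := by
  have hsplit : P = (P ∩ {ω | g ∈ ω}) ∪ (P ∩ {ω | g ∉ ω}) := by
    ext ω; simp only [mem_union, mem_inter_iff, mem_setOf_eq]; tauto
  rw [hsplit, fibreCount_split_left _ _ _ (Set.disjoint_left.2 fun ω h₁ h₂ => h₂.2 h₁.2), ← hsplit]
  congr 1
  · -- `g ∈ ω`: remove it
    symm
    refine fibreCount_eq_of_bij (fun ω => insert g ω) (fun ω => ω \ {g}) (fun ω hω hA hB => ?_) (fun ω hω hA hB => ?_)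
    · obtain ⟨hg, hP⟩ := hA
      obtain ⟨-, hQ⟩ := hB
      have hg' : g ∉ ω := hg
      refine ⟨by rw [insert_sdiff_insert_of_notMem hg', hω], ⟨hP, mem_insert _ _⟩,
        by rw [insert_symmDiff_insert_of_notMem hg' hgM]; exact hQ, insert_sdiff_self_of_notMem hg'⟩
    · obtain ⟨hP, hg⟩ := hA
      have hg' : g ∈ ω := hg
      have hg0 : g ∉ ω \ {g} := fun h => h.2 rfl
      have hback : insert g (ω \ {g}) = ω := by rw [insert_sdiff_singleton, insert_eq_of_mem hg']
      refine ⟨sdiff_singleton_sdiff_of_fibre hω, ⟨hg0, by rw [mem_setOf_eq, hback]; exact hP⟩,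
        ⟨notMem_symmDiff_of_notMem hg0 hgM, ?_⟩, hback⟩
      show (ω \ {g}) ∆ M ∈ Q
      rw [← insert_symmDiff_insert_of_notMem hg0 hgM, hback]; exact hB
  · -- `g ∉ ω`: the identity
    symm
    refine fibreCount_eq_of_bij id id (fun ω hω hA hB => ?_) (fun ω hω hA hB => ?_)
    · obtain ⟨hg, hP⟩ := hA
      obtain ⟨-, hQ⟩ := hB
      have hg' : g ∉ ω := hg
      refine ⟨?_, ⟨hP, hg'⟩, ?_, rfl⟩
      · show ω \ insert g M = u
        rw [sdiff_insert_of_notMem hg', hω]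
      · show ω ∆ insert g M ∈ Q
        rw [symmDiff_insert_of_notMem hg']; exact hQ
    · obtain ⟨hP, hg⟩ := hA
      have hg' : g ∉ ω := hg
      refine ⟨?_, ⟨hg', hP⟩, ⟨notMem_symmDiff_of_notMem hg' hgM, ?_⟩, rfl⟩
      · show ω \ M = u
        rw [← sdiff_insert_of_notMem hg', hω]
      · show insert g (ω ∆ M) ∈ Q
        rw [← symmDiff_insert_of_notMem hg']; exact hB

end OnePair

/-! ### Forests with pairs inserted at an ISOLATED vertex -/

section Isolated

variable {ω : BondConfig V} {o : V}

omit [Fintype V] in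
/-- From an isolated vertex no open path leaves. [folklore] -/
theorem eq_of_reachable_of_isolated (ho : ∀ p ∈ ω, o ∉ p) {x : V} (h : (openGraph ω).Reachable o x) : x = o := by
  obtain ⟨p⟩ := h
  cases p with
  | nil => rfl
  | cons hadj _ => exact absurd (Sym2.mem_mk_left _ _) (ho _ ((openGraph_adj _ _ _).1 hadj).1)

omit [Fintype V] in
/-- A pair at an isolated vertex is absent. [folklore] -/
theorem notMem_of_isolated (ho : ∀ p ∈ ω, o ∉ p) (x : V) : s(o, x) ∉ ω := fun h => ho _ h (Sym2.mem_mk_left _ _)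

omit [Fintype V] in
/-- **One pendant pair at an isolated vertex**: `ω ∪ {ox} ∈ Fo ↔ ω ∈ Fo` (`o ≠ x`). [cite: Grimmett2006, §1.5 (p. 13)] -/
theorem isForestCfg_insert_of_isolated (ho : ∀ p ∈ ω, o ∉ p) {x : V} (hx : o ≠ x) :
    IsForestCfg (insert s(o, x) ω) ↔ IsForestCfg ω :=
  (isForestCfg_insert_iff hx (notMem_of_isolated ho x)).trans ⟨fun h => h.1, fun h => ⟨h, not_reachable_of_isolated ho hx.symm⟩⟩

omit [Fintype V] in
/-- **Two pairs at an isolated vertex**: `ω ∪ {ov, oy} ∈ Fo ↔ ω ∈ Fo ∧ v ↮ y` (`o, v, y` distinct).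
[cite: CibulkaHladkyLaCroixWagner2008, Thm. 1 (p. 2)] -/
theorem isForestCfg_insert_two_of_isolated (ho : ∀ p ∈ ω, o ∉ p) {v y : V} (hov : o ≠ v) (hoy : o ≠ y) (hvy : v ≠ y) :
    IsForestCfg (insert s(o, y) (insert s(o, v) ω)) ↔ IsForestCfg ω ∧ ¬ (openGraph ω).Reachable v y := by
  rw [ForestSquareCex.isForestCfg_insert_two_iff hov hoy hvy (notMem_of_isolated ho v) (notMem_of_isolated ho y)]
  exact ⟨fun h => ⟨h.1, h.2.2.2⟩, fun h => ⟨h.1, not_reachable_of_isolated ho hov.symm, not_reachable_of_isolated ho hoy.symm, h.2⟩⟩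

omit [Fintype V] in
/-- Reachability from the formerly isolated vertex after one pendant pair `oz`: `o ~ x` in `ω ∪ {oz}` iff `x = o` or `z ~ x` in `ω`.
[folklore] -/
theorem reachable_insert_of_isolated_iff (ho : ∀ p ∈ ω, o ∉ p) (z x : V) :
    (openGraph (insert s(o, z) ω)).Reachable o x ↔ x = o ∨ (openGraph ω).Reachable z x := by
  rw [KNSep.reachable_insert_iff]
  constructor
  · rintro (h | ⟨-, h⟩ | ⟨h, h'⟩)
    · exact Or.inl (eq_of_reachable_of_isolated ho h)
    · exact Or.inr h
    · exact Or.inl (eq_of_reachable_of_isolated ho h')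
  · rintro (rfl | h)
    · exact Or.inl (SimpleGraph.Reachable.refl _)
    · exact Or.inr (Or.inl ⟨SimpleGraph.Reachable.refl _, h⟩)

omit [Fintype V] in
/-- **Three pairs at an isolated vertex**: `ω ∪ {oz, ov, oy} ∈ Fo ↔ ω ∈ Fo ∧ v ↮ y ∧ v ↮ z ∧ y ↮ z` (`o, v, y, z` distinct).
[cite: CibulkaHladkyLaCroixWagner2008, Thm. 1 (p. 2)] [cite: Grimmett2006, §1.5 (p. 13)] -/
theorem isForestCfg_insert_three_of_isolated (ho : ∀ p ∈ ω, o ∉ p) {v y z : V} (hov : o ≠ v) (hoy : o ≠ y) (hoz : o ≠ z)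
    (hvy : v ≠ y) (hvz : v ≠ z) (hyz : y ≠ z) :
    IsForestCfg (insert s(o, y) (insert s(o, v) (insert s(o, z) ω))) ↔
      IsForestCfg ω ∧ ¬ (openGraph ω).Reachable v y ∧ ¬ (openGraph ω).Reachable v z ∧ ¬ (openGraph ω).Reachable y z := by
  have hez : s(o, v) ∉ insert s(o, z) ω := by
    rw [mem_insert_iff, not_or]; exact ⟨fun h => hvz (Sym2.congr_right.1 h), notMem_of_isolated ho v⟩
  have hfz : s(o, y) ∉ insert s(o, z) ω := by
    rw [mem_insert_iff, not_or]; exact ⟨fun h => hyz (Sym2.congr_right.1 h), notMem_of_isolated ho y⟩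
  rw [ForestSquareCex.isForestCfg_insert_two_iff hov hoy hvy hez hfz, isForestCfg_insert_iff hoz (notMem_of_isolated ho z),
    reachable_insert_of_isolated_iff ho, reachable_insert_of_isolated_iff ho, KNSep.reachable_insert_iff]
  have hvo : ¬ (openGraph ω).Reachable v o := fun h => hov (eq_of_reachable_of_isolated ho h.symm).symm
  have hoy' : ¬ (openGraph ω).Reachable o y := not_reachable_of_isolated ho hoy.symm
  constructor
  · rintro ⟨⟨hF, -⟩, hv, hy, hvy'⟩
    exact ⟨hF, fun h => hvy' (Or.inl h), fun h => hv (Or.inr h.symm), fun h => hy (Or.inr h.symm)⟩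
  · rintro ⟨hF, h1, h2, h3⟩
    refine ⟨⟨hF, not_reachable_of_isolated ho hoz.symm⟩, ?_, ?_, ?_⟩
    · rintro (h | h)
      · exact hov h.symm
      · exact h2 h.symm
    · rintro (h | h)
      · exact hoy h.symm
      · exact h3 h.symm
    · rintro (h | ⟨h, -⟩ | ⟨-, h⟩)
      · exact h1 h
      · exact hvo h
      · exact hoy' h

end Isolated

/-! ### The degree-≤-3 case of the square-free node -/

section DegThree

variable {M u₀ : BondConfig V} {o v y z : V}

omit [Fintype V] in
/-- If every pair of `M ∪ u₀` containing `o` equals `g = oz`, then `o` is isolated in every `ω' ⊆ M ∪ u₀` avoiding `g`. [folklore] -/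
theorem isolated_of_subset (hdeg : ∀ p ∈ M ∪ u₀, o ∈ p → p = s(o, z)) {ω' : BondConfig V} (hsub : ω' ⊆ M ∪ u₀)
    (hg : s(o, z) ∉ ω') : ∀ p ∈ ω', o ∉ p :=
  fun p hp hop => hg ((hdeg p (hsub hp) hop) ▸ hp)

omit [Fintype V] in
/-- Configurations of the fibre `(M, u₀)` lie inside `M ∪ u₀`, and so do their partners. [folklore] -/
theorem subset_union_of_fibre {ω : BondConfig V} (hω : ω \ M = u₀) : ω ⊆ M ∪ u₀ ∧ ω ∆ M ⊆ M ∪ u₀ := by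
  refine ⟨fun x hx => ?_, fun x hx => ?_⟩
  · by_cases hxM : x ∈ M
    · exact Or.inl hxM
    · exact Or.inr (hω ▸ ⟨hx, hxM⟩)
  · rcases (Set.mem_symmDiff).1 hx with ⟨hx, hxM⟩ | ⟨hxM, -⟩
    · exact Or.inr (hω ▸ ⟨hx, hxM⟩)
    · exact Or.inl hxM

/-- **The guarded square-free inequality at a vertex of degree ≤ 3.**  Fibre `(M, u₀)`, `e = ov`, `f = oy` outside `M ∪ u₀`
(`o, v, y` distinct), and every pair of `M ∪ u₀` containing `o` is the single pair `g = oz` (`z ≠ o`), which is not in `u₀`.  Then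
`#_{(M,u₀)}(G ∩ {ω ∪ {e,f} ∈ Fo}, G ∩ Fo) ≤ #_{(M,u₀)}(G ∩ {ω ∪ {e} ∈ Fo}, G ∩ {ω ∪ {f} ∈ Fo})`, `G = {e ∉ ω ∧ f ∉ ω}`.
[cite: SempleWelsh2008, Conj. 1.1 (p. 2)] [cite: CibulkaHladkyLaCroixWagner2008, Thm. 1 (p. 2)] [cite: Linusson2011, Prop. 2.6] -/
theorem adjForestNoSq_guarded_of_deg_le_three (hov : o ≠ v) (hoy : o ≠ y) (hvy : v ≠ y) (hoz : o ≠ z)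
    (heM : s(o, v) ∉ M) (hfM : s(o, y) ∉ M) (heu : s(o, v) ∉ u₀) (hfu : s(o, y) ∉ u₀)
    (hdeg : ∀ p ∈ M ∪ u₀, o ∈ p → p = s(o, z)) (hgu : s(o, z) ∉ u₀) :
    fibreCount M u₀ ({ω | s(o, v) ∉ ω ∧ s(o, y) ∉ ω} ∩ {ω | insert s(o, y) (insert s(o, v) ω) ∈ forestEv V})
        ({ω | s(o, v) ∉ ω ∧ s(o, y) ∉ ω} ∩ forestEv V) ≤
      fibreCount M u₀ ({ω | s(o, v) ∉ ω ∧ s(o, y) ∉ ω} ∩ {ω | insert s(o, v) ω ∈ forestEv V})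
        ({ω | s(o, v) ∉ ω ∧ s(o, y) ∉ ω} ∩ {ω | insert s(o, y) ω ∈ forestEv V}) := by
  set G : Set (BondConfig V) := {ω | s(o, v) ∉ ω ∧ s(o, y) ∉ ω} with hG
  -- `e, f` are absent from every configuration inside `M ∪ u₀`
  have hGsub : ∀ ω' : BondConfig V, ω' ⊆ M ∪ u₀ → ω' ∈ G := fun ω' h =>
    ⟨fun he => (h he).elim heM heu, fun hf => (h hf).elim hfM hfu⟩
  by_cases hgM : s(o, z) ∈ M
  · -- DEGREE 3: split off `g = oz`
    set M₁ : BondConfig V := M \ {s(o, z)} with hM₁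
    have hgM₁ : s(o, z) ∉ M₁ := fun h => h.2 rfl
    have hM : M = insert s(o, z) M₁ := by rw [hM₁, insert_sdiff_singleton, insert_eq_of_mem hgM]
    have hvz : v ≠ z := fun h => heM (h ▸ hgM)
    have hyz : y ≠ z := fun h => hfM (h ▸ hgM)
    have hsub₁ : M₁ ∪ u₀ ⊆ M ∪ u₀ := union_subset_union_left _ sdiff_subset
    -- on the fibre `(M₁, u₀)`: configurations avoiding `g` have `o` isolated, and so do their partners
    have iso : ∀ ω : BondConfig V, ω \ M₁ = u₀ → s(o, z) ∉ ω →
        (∀ p ∈ ω, o ∉ p) ∧ (∀ p ∈ ω ∆ M₁, o ∉ p) ∧ ω ∈ G ∧ ω ∆ M₁ ∈ G := by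
      intro ω hω hg
      have h := subset_union_of_fibre hω
      have hg' : s(o, z) ∉ ω ∆ M₁ := notMem_symmDiff_of_notMem hg hgM₁
      exact ⟨isolated_of_subset hdeg (h.1.trans hsub₁) hg, isolated_of_subset hdeg (h.2.trans hsub₁) hg',
        hGsub _ (h.1.trans hsub₁), hGsub _ (h.2.trans hsub₁)⟩
    have hGins : ∀ ω : BondConfig V, ω \ M₁ = u₀ → insert s(o, z) ω ∈ G ∧ insert s(o, z) (ω ∆ M₁) ∈ G := fun ω hω =>
      ⟨hGsub _ (insert_subset (Or.inl hgM) ((subset_union_of_fibre hω).1.trans hsub₁)),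
        hGsub _ (insert_subset (Or.inl hgM) ((subset_union_of_fibre hω).2.trans hsub₁))⟩
    rw [hM, fibreCount_insert_one hgM₁, fibreCount_insert_one hgM₁]
    -- the four counts, as events on ONE configuration `ω` of `(M₁, u₀)` (base event `Bs`)
    set Bs : Set (BondConfig V) := {ω | s(o, z) ∉ ω} ∩ (forestEv V ∩ {ω | ω ∆ M₁ ∈ forestEv V}) with hBs
    have e_bad₁ : fibreCount M₁ u₀ ({ω | s(o, z) ∉ ω} ∩ {ω | insert s(o, z) ω ∈ G ∩ {ω | insert s(o, y) (insert s(o, v) ω) ∈ forestEv V}})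
        ({ω | s(o, z) ∉ ω} ∩ (G ∩ forestEv V)) =
        fibreCount M₁ u₀ (Bs ∩ {ω | ¬ (openGraph ω).Reachable v y ∧ ¬ (openGraph ω).Reachable v z ∧
          ¬ (openGraph ω).Reachable y z}) univ := by
      refine fibreCount_congr_fibre M₁ u₀ fun ω hω => ⟨fun ⟨⟨hg, _, hF⟩, ⟨_, _, hFB⟩⟩ => ?_, fun ⟨⟨⟨hg, hF, hFB⟩, h3⟩, _⟩ => ?_⟩
      · have hi := iso ω hω hg
        have h3 := (isForestCfg_insert_three_of_isolated hi.1 hov hoy hoz hvy hvz hyz).1 hF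
        exact ⟨⟨⟨hg, h3.1, hFB⟩, h3.2⟩, mem_univ _⟩
      · have hi := iso ω hω hg
        exact ⟨⟨hg, (hGins ω hω).1, (isForestCfg_insert_three_of_isolated hi.1 hov hoy hoz hvy hvz hyz).2 ⟨hF, h3⟩⟩,
          ⟨notMem_symmDiff_of_notMem hg hgM₁, hi.2.2.2, hFB⟩⟩
    have e_bad₂ : fibreCount M₁ u₀ ({ω | s(o, z) ∉ ω} ∩ (G ∩ {ω | insert s(o, y) (insert s(o, v) ω) ∈ forestEv V}))
        ({ω | s(o, z) ∉ ω} ∩ {ω | insert s(o, z) ω ∈ G ∩ forestEv V}) =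
        fibreCount M₁ u₀ (Bs ∩ {ω | ¬ (openGraph ω).Reachable v y}) univ := by
      refine fibreCount_congr_fibre M₁ u₀ fun ω hω => ⟨fun ⟨⟨hg, _, hF⟩, ⟨_, _, hFB⟩⟩ => ?_, fun ⟨⟨⟨hg, hF, hFB⟩, h1⟩, _⟩ => ?_⟩
      · have hi := iso ω hω hg
        have h2 := (isForestCfg_insert_two_of_isolated hi.1 hov hoy hvy).1 hF
        exact ⟨⟨⟨hg, h2.1, (isForestCfg_insert_of_isolated hi.2.1 hoz).1 hFB⟩, h2.2⟩, mem_univ _⟩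
      · have hi := iso ω hω hg
        exact ⟨⟨hg, hi.2.2.1, (isForestCfg_insert_two_of_isolated hi.1 hov hoy hvy).2 ⟨hF, h1⟩⟩,
          ⟨notMem_symmDiff_of_notMem hg hgM₁, (hGins ω hω).2, (isForestCfg_insert_of_isolated hi.2.1 hoz).2 hFB⟩⟩
    have e_good₁ : fibreCount M₁ u₀ ({ω | s(o, z) ∉ ω} ∩ {ω | insert s(o, z) ω ∈ G ∩ {ω | insert s(o, v) ω ∈ forestEv V}})
        ({ω | s(o, z) ∉ ω} ∩ (G ∩ {ω | insert s(o, y) ω ∈ forestEv V})) =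
        fibreCount M₁ u₀ (Bs ∩ {ω | ¬ (openGraph ω).Reachable v z}) univ := by
      refine fibreCount_congr_fibre M₁ u₀ fun ω hω => ⟨fun ⟨⟨hg, _, hF⟩, ⟨_, _, hFB⟩⟩ => ?_, fun ⟨⟨⟨hg, hF, hFB⟩, h1⟩, _⟩ => ?_⟩
      · have hi := iso ω hω hg
        have h2 := (isForestCfg_insert_two_of_isolated hi.1 hoz hov hvz.symm).1 hF
        exact ⟨⟨⟨hg, h2.1, (isForestCfg_insert_of_isolated hi.2.1 hoy).1 hFB⟩, fun h => h2.2 h.symm⟩, mem_univ _⟩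
      · have hi := iso ω hω hg
        exact ⟨⟨hg, (hGins ω hω).1, (isForestCfg_insert_two_of_isolated hi.1 hoz hov hvz.symm).2 ⟨hF, fun h => h1 h.symm⟩⟩,
          ⟨notMem_symmDiff_of_notMem hg hgM₁, hi.2.2.2, (isForestCfg_insert_of_isolated hi.2.1 hoy).2 hFB⟩⟩
    have e_good₂ : fibreCount M₁ u₀ ({ω | s(o, z) ∉ ω} ∩ (G ∩ {ω | insert s(o, v) ω ∈ forestEv V}))
        ({ω | s(o, z) ∉ ω} ∩ {ω | insert s(o, z) ω ∈ G ∩ {ω | insert s(o, y) ω ∈ forestEv V}}) =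
        fibreCount M₁ u₀ (Bs ∩ {ω | ¬ (openGraph ω).Reachable y z}) univ := by
      rw [fibreCount_swap M₁ u₀ ({ω | s(o, z) ∉ ω} ∩ (G ∩ {ω | insert s(o, v) ω ∈ forestEv V}))]
      refine fibreCount_congr_fibre M₁ u₀ fun ω hω => ⟨fun ⟨⟨hg, _, hF⟩, ⟨_, _, hFB⟩⟩ => ?_, fun ⟨⟨⟨hg, hF, hFB⟩, h1⟩, _⟩ => ?_⟩
      · have hi := iso ω hω hg
        have h2 := (isForestCfg_insert_two_of_isolated hi.1 hoz hoy hyz.symm).1 hF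
        exact ⟨⟨⟨hg, h2.1, (isForestCfg_insert_of_isolated hi.2.1 hov).1 hFB⟩, fun h => h2.2 h.symm⟩, mem_univ _⟩
      · have hi := iso ω hω hg
        exact ⟨⟨hg, (hGins ω hω).1, (isForestCfg_insert_two_of_isolated hi.1 hoz hoy hyz.symm).2 ⟨hF, fun h => h1 h.symm⟩⟩,
          ⟨notMem_symmDiff_of_notMem hg hgM₁, hi.2.2.2, (isForestCfg_insert_of_isolated hi.2.1 hov).2 hFB⟩⟩
    rw [e_bad₁, e_bad₂, e_good₁, e_good₂]
    -- pointwise: {v|y|z} ⊔ {v ↮ y, v ~ z} ⊆ {y ↮ z} and {v ↮ y, v ↮ z} ⊆ {v ↮ z}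
    have hsplit : Bs ∩ {ω | ¬ (openGraph ω).Reachable v y} =
        (Bs ∩ {ω | ¬ (openGraph ω).Reachable v y ∧ ¬ (openGraph ω).Reachable v z}) ∪
          (Bs ∩ {ω | ¬ (openGraph ω).Reachable v y ∧ (openGraph ω).Reachable v z}) := by
      ext ω; simp only [mem_inter_iff, mem_setOf_eq, mem_union]; tauto
    rw [hsplit, fibreCount_split_left _ _ _ (Set.disjoint_left.2 fun ω h₁ h₂ => h₁.2.2 h₂.2.2)]
    have h1 : fibreCount M₁ u₀ (Bs ∩ {ω | ¬ (openGraph ω).Reachable v y ∧ ¬ (openGraph ω).Reachable v z}) univ ≤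
        fibreCount M₁ u₀ (Bs ∩ {ω | ¬ (openGraph ω).Reachable v z}) univ :=
      fibreCount_mono_fibre M₁ u₀ fun ω _ hA hB => ⟨⟨hA.1, hA.2.2⟩, hB⟩
    have h2 : fibreCount M₁ u₀ (Bs ∩ {ω | ¬ (openGraph ω).Reachable v y ∧ ¬ (openGraph ω).Reachable v z ∧
          ¬ (openGraph ω).Reachable y z}) univ +
        fibreCount M₁ u₀ (Bs ∩ {ω | ¬ (openGraph ω).Reachable v y ∧ (openGraph ω).Reachable v z}) univ ≤
        fibreCount M₁ u₀ (Bs ∩ {ω | ¬ (openGraph ω).Reachable y z}) univ := by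
      rw [← fibreCount_split_left _ _ _ (Set.disjoint_left.2 fun ω h₁ h₂ => h₁.2.2.1 h₂.2.2)]
      refine fibreCount_mono_fibre M₁ u₀ fun ω _ hA hB => ⟨?_, hB⟩
      rcases hA with ⟨hb, -, -, h⟩ | ⟨hb, hvy', hvz'⟩
      · exact ⟨hb, h⟩
      · exact ⟨hb, fun h => hvy' (hvz'.trans h.symm)⟩
    omega
  · -- DEGREE 2: `o` is isolated in every configuration of the fibre and in its partner; `bad ⊆ good` pointwise
    refine fibreCount_mono_fibre M u₀ fun ω hω hA hB => ?_
    have h := subset_union_of_fibre hω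
    have hi₁ : ∀ p ∈ ω, o ∉ p := isolated_of_subset hdeg h.1 fun h' => (h.1 h').elim hgM hgu
    have hi₂ : ∀ p ∈ ω ∆ M, o ∉ p := isolated_of_subset hdeg h.2 fun h' => (h.2 h').elim hgM hgu
    obtain ⟨hGω, hF⟩ := hA
    obtain ⟨hGB, hFB⟩ := hB
    have hF' : IsForestCfg ω := ((isForestCfg_insert_two_of_isolated hi₁ hov hoy hvy).1 hF).1
    exact ⟨⟨hGω, (isForestCfg_insert_of_isolated hi₁ hov).2 hF'⟩, ⟨hGB, (isForestCfg_insert_of_isolated hi₂ hoy).2 hFB⟩⟩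

/-- **The square-free adjacent forest Rayleigh inequality on the split fibre `(M ∪ {e,f}, u₀)` at a vertex of degree ≤ 3**:
`#(Fo ∩ {e, f ∈ ω}, Fo) ≤ #(Fo ∩ {e ∈ ω}, Fo ∩ {f ∈ ω})` whenever the only pair of `M ∪ u₀` at `o` (if any) is one pair `oz ∉ u₀`.
[cite: SempleWelsh2008, Conj. 1.1 (p. 2)] [cite: CibulkaHladkyLaCroixWagner2008, Thm. 1 (p. 2)] [cite: Linusson2011, Prop. 2.6] -/
theorem adjForestNoSq_fibre_of_deg_le_three (hov : o ≠ v) (hoy : o ≠ y) (hvy : v ≠ y) (hoz : o ≠ z)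
    (heM : s(o, v) ∉ M) (hfM : s(o, y) ∉ M) (heu : s(o, v) ∉ u₀) (hfu : s(o, y) ∉ u₀)
    (hdeg : ∀ p ∈ M ∪ u₀, o ∈ p → p = s(o, z)) (hgu : s(o, z) ∉ u₀) :
    fibreCount (insert s(o, y) (insert s(o, v) M)) u₀ (forestEv V ∩ {ω | s(o, v) ∈ ω ∧ s(o, y) ∈ ω}) (forestEv V) ≤
      fibreCount (insert s(o, y) (insert s(o, v) M)) u₀ (forestEv V ∩ {ω | s(o, v) ∈ ω}) (forestEv V ∩ {ω | s(o, y) ∈ ω}) :=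
  adjForestNoSq_fibre_of_guarded hvy heM hfM (adjForestNoSq_guarded_of_deg_le_three hov hoy hvy hoz heM hfM heu hfu hdeg hgu)

end DegThree

end FK
end Summit.CriticalPhenomena.PercolationContinuityZ3.Theorems

end
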